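import Literature.AlgebraicGeometry.HodgeTheory.WeilClassesMoonenZarhinCriterionHolds
import Literature.AlgebraicGeometry.VanGeemen1994.WeilTypeHodgeGroupSU
import HarnessLib

/-!
# An automorphism of `H¹` whose exterior power is the identity on the Weil classes of `F` is `F`-linear and
# lies in `SL_F` (Moonen–Zarhin 1998 §1, Lemma (2), on the complexified carrier, for ANY multiplicative pair)

Layer `Literature/AlgebraicGeometry/HodgeTheory`, theorem-only companion of `WeilClassesMoonenZarhinCriterion(Holds)`
(`weilClassesField A φ P r = ⨆_{P(ρ)=0} ⋀ʳ V_{ℂ,ρ} ⊆ Hʳ(A(ℂ); ℂ)`, `V_{ℂ,ρ} = ker(φ^* − ρ) ⊆ H¹(A(ℂ); ℂ)`, for the field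
`F = ℚ(φ) ≅ ℚ[T]/(P) ⊂ End⁰(A)`) and of `VanGeemen1994/WeilTypeHodgeGroupSU` (`detOnEigenspace u T hc ε = det(u | ker(T − ε))`,
`pullbackOne A φ = φ^*|_{H¹}`).  Everything is proved; no definition, no named fact.

PRINTED STATEMENT.  B. J. J. Moonen – Yu. G. Zarhin, *Weil classes on abelian varieties*, J. reine angew. Math. 496
(1998) 83–92 = arXiv:alg-geom/9612017 (held text `paper:arxiv-alg-geom_9612017`, chunk p0003, lines 12–45), §1, Lemma:
«(1) The space `W_F = ⋀^r_F V` can naturally be identified with a subspace of `⋀^r_ℚ V`.  (2) If `g ∈ Gl_ℚ(V)` acts as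
the identity on `W_F` then `g` is `F`-linear, hence `g ∈ Sl_F(V)`.»  (Proof in print: with an `F`-basis,
`det_F(t₁, …, t_r) = det_F(g·t₁, …, g·t_r)` for all `tᵢ ∈ V^∨`, whence `det_F(g·(f t₁), g·t₂, …) = det_F(f(g·t₁), g·t₂, …)`
«and (2) readily follows from this».)  The tree's `Deligne1982/WeilTypeCMHodgeGroupLeSU` proves (2) for the elements of the
HODGE GROUP, for which `F`-linearity is automatic (honest column there: «Moonen–Zarhin state Lemma (2) for an arbitrary
`g ∈ GL_ℚ(V)` … here it is proved for the elements of the Hodge group»); THIS file proves it for an ARBITRARY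
automorphism, where `F`-linearity is the content.

RENDERING ON THE CARRIERS.  `V ⊗ ℂ = H¹(A(ℂ); ℂ)`, `⋀ʳ(V ⊗ ℂ) = Hʳ(A(ℂ); ℂ)` (`H•(A) = ⋀•H¹`, the tree's
`Motives.AbelianVariety.hasExteriorCohomologyH1_complexPoints`; wedges are the iterated cup products `cupPowOne`).  «`g`
acts on `⋀ʳ V`» = a MULTIPLICATIVE PAIR `(u, U)`: `u` an automorphism of `H¹(A(ℂ); ℂ)` and `U` a linear endomorphism of
`Hʳ(A(ℂ); ℂ)` with `U(v₁ ∪ ⋯ ∪ v_r) = u v₁ ∪ ⋯ ∪ u v_r` (e.g. `(g₁, g_r)` for `g` in the Hodge group,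
`hodgeGroup_apply_cupPowOne`; `⋀ʳ u` for `u` in Milne's `S(A)(ℂ)`; a Künneth family); «identity on `W_F`» = `U c = c` on
`weilClassesField A φ P r = W_F ⊗ ℂ`; «`F`-linear» = `u ∘ φ^* = φ^* ∘ u`; «`g ∈ Sl_F(V)`» = `det(u | V_ρ) = 1` at every
complex root `ρ` of `P` (`det_F ⊗ ℂ = (det(· | V_σ))_σ`).

WHAT IS PROVED.  `P ∈ ℤ[T]` monic irreducible of degree `e`, `P(φ) = 0`, `e · r = 2 dim A`.
* §1 EXTERIOR ALGEBRA OF `H•(A(ℂ); ℂ)` (Lange Lemma 1.1.17 / Exercise 1.1.6 (7) on the carrier):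
  **`mem_span_of_cupProduct_cupPowOne_eq_zero`** — for linearly independent `w₁, …, w_d ∈ H¹` and `x ∈ H¹`:
  `x ∪ (w₁ ∪ ⋯ ∪ w_d) = 0 ⟹ x ∈ span {wᵢ}` (else `x, w₁, …, w_d` are independent and their product is non-zero,
  `cupPowOne_ne_zero_of_linearIndependent`); **`span_range_eq_of_cupPowOne_eq`** — `u w₁ ∪ ⋯ ∪ u w_d = w₁ ∪ ⋯ ∪ w_d` for
  independent `w` ⟹ `span {u wᵢ} = span {wᵢ}` («a non-zero decomposable `d`-vector determines its `d`-plane»).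
* §2 LEMMA (2), FIRST HALF — `F`-LINEARITY: **`comm_pullbackOne_of_forall_apply_eq_of_mem_weilClassesField`** — if the
  multiplicative pair `(u, U)` has `U = id` on `W_F ⊗ ℂ`, then `u` maps every `V_ρ` into itself
  (`mapsTo_eigenspace_of_forall_apply_eq_of_mem_weilClassesField`) and commutes with `φ^*`
  (`H¹ = ⊕_ρ V_ρ`, the tree's `exists_eigenbasis_complexBetti_one`).
* §3 LEMMA (2), SECOND HALF — `Sl_F`: **`detOnEigenspace_eq_one_of_forall_apply_eq_of_mem_weilClassesField`** —
  … and `det(u | V_ρ) = 1` at every root (`U(w₁ ∪ ⋯ ∪ w_r) = det(u|V_ρ) · (w₁ ∪ ⋯ ∪ w_r)` for a basis `w` of `V_ρ`,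
  `dim V_ρ = r`; `apply_cupPowOne_eq_detOnEigenspace_smul_of_comm`).
* §4 THE CONVERSE and the EQUIVALENCE: `apply_eq_of_mem_weilClassesField_of_comm_of_detOnEigenspace_eq_one` and
  **`forall_apply_eq_of_mem_weilClassesField_iff`** — for a multiplicative pair `(u, U)`: `U = id` on `W_F ⊗ ℂ` iff
  (`u` is `F`-linear and `det(u | V_ρ) = 1` for all `ρ`), i.e. iff `u ∈ Sl_F(V)(ℂ)`.

No `sorry`; axioms `propext`, `Classical.choice`, `Quot.sound`.

## References
* [MoonenZarhin1998WeilClasses] B. J. J. Moonen, Yu. G. Zarhin, *Weil classes on abelian varieties*, J. reine angew.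
  Math. 496 (1998) 83–92 = arXiv:alg-geom/9612017, §1 Lemma (1)–(2) and its proof (chunk p0003, lines 12–45).
* [Lange2023AbelianVarietiesC] H. Lange, *Abelian Varieties over the Complex Numbers* (2023), Lemma 1.1.17 and Exercise
  1.1.6 (7) (`H•(X, ℤ) = ⋀•H¹`).
* [vanGeemen1994HodgeAV] B. van Geemen, LNM 1594 (1994), 6.5 and 6.9–6.10 (`det(B ± √−d C)`, the quadratic case).
* [HatcherAT2002] A. Hatcher, *Algebraic Topology* (2002), §3.2 (cup product, Example 3.16).
-/

noncomputable section

open CategoryTheory Polynomial Module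

namespace Literature.AlgebraicGeometry.HodgeTheory

open Literature.AlgebraicGeometry.Motives (AbelianVariety IsSmoothProjective ComplexPoints)
open Literature.AlgebraicGeometry.VanGeemen1994 (pullbackOne detOnEigenspace mapsTo_eigenspace_of_comm)
open Literature.AlgebraicTopology.SingularHomology

section HodgeTheory

variable {A : AbelianVariety ℂ}

/-! ### §1 Exterior algebra of `H•(A(ℂ); ℂ)`: a non-zero decomposable class determines its plane -/

section Exterior

/-- **`x ∪ (w₁ ∪ ⋯ ∪ w_d) = 0` with `w` linearly independent ⟹ `x ∈ span {wᵢ}`** in `H•(A(ℂ); ℂ) = ⋀•H¹`: otherwise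
`x, w₁, …, w_d` are linearly independent and `x ∪ w₁ ∪ ⋯ ∪ w_d ≠ 0` (`cupPowOne_ne_zero_of_linearIndependent`).
[cite: Lange2023AbelianVarietiesC, Lemma 1.1.17 and Exercise 1.1.6 (7)] [cite: HatcherAT2002, §3.2 Example 3.16] -/
theorem mem_span_of_cupProduct_cupPowOne_eq_zero {d : ℕ} {w : Fin d → complexBetti A.X 1}
    (hw : LinearIndependent ℂ w) {x : complexBetti A.X 1}
    (hx : cupProduct (Nat.add_comm 1 d) x (cupPowOne ℂ (ComplexPoints A.X) d w) = 0) :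
    x ∈ Submodule.span ℂ (Set.range w) := by
  by_contra hxs
  have hli : LinearIndependent ℂ (Fin.cons x w : Fin (d + 1) → complexBetti A.X 1) :=
    linearIndependent_finCons.2 ⟨hw, hxs⟩
  have hne := cupPowOne_ne_zero_of_linearIndependent A hli
  rw [← cupProduct_cupPowOne] at hne
  exact hne hx

/-- Each `u wᵢ` lies in `span {wⱼ}` as soon as `u w₁ ∪ ⋯ ∪ u w_d = w₁ ∪ ⋯ ∪ w_d` for an independent family `w` (any map
`u`): `u wᵢ ∪ (u w₁ ∪ ⋯ ∪ u w_d) = 0` (a repeated degree-one factor, `cup_cupPowOne_eq_zero_of_eq`).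
[cite: Lange2023AbelianVarietiesC, Lemma 1.1.17 and Exercise 1.1.6 (7)] -/
theorem apply_mem_span_of_cupPowOne_eq {d : ℕ} {w : Fin d → complexBetti A.X 1} (hw : LinearIndependent ℂ w)
    (u : complexBetti A.X 1 → complexBetti A.X 1)
    (h : cupPowOne ℂ (ComplexPoints A.X) d (fun i => u (w i)) = cupPowOne ℂ (ComplexPoints A.X) d w) (i : Fin d) :
    u (w i) ∈ Submodule.span ℂ (Set.range w) := by
  refine mem_span_of_cupProduct_cupPowOne_eq_zero hw ?_
  rw [← h]
  exact cup_cupPowOne_eq_zero_of_eq d (fun i => u (w i)) i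

/-- **A non-zero decomposable `d`-class determines its `d`-plane**: for a linear map `u` and an independent family `w` with
`u w₁ ∪ ⋯ ∪ u w_d = w₁ ∪ ⋯ ∪ w_d`, `span {u wᵢ} = span {wᵢ}`. [cite: Lange2023AbelianVarietiesC, Lemma 1.1.17 and
Exercise 1.1.6 (7)] [cite: MoonenZarhin1998WeilClasses, §1 proof of Lemma (2) (chunk p0003)] -/
theorem span_range_eq_of_cupPowOne_eq {d : ℕ} {w : Fin d → complexBetti A.X 1} (hw : LinearIndependent ℂ w)
    (u : complexBetti A.X 1 →ₗ[ℂ] complexBetti A.X 1)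
    (h : cupPowOne ℂ (ComplexPoints A.X) d (fun i => u (w i)) = cupPowOne ℂ (ComplexPoints A.X) d w) :
    Submodule.span ℂ (Set.range fun i => u (w i)) = Submodule.span ℂ (Set.range w) := by
  classical
  haveI := finite_complexBetti_abelianVariety A 1
  have hle : Submodule.span ℂ (Set.range fun i => u (w i)) ≤ Submodule.span ℂ (Set.range w) :=
    Submodule.span_le.2 (by rintro _ ⟨i, rfl⟩; exact apply_mem_span_of_cupPowOne_eq hw u h i)
  -- the `u wᵢ` are independent too (their product is the non-zero class `w₁ ∪ ⋯ ∪ w_d`), so the dimensions agree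
  have hne : cupPowOne ℂ (ComplexPoints A.X) d (fun i => u (w i)) ≠ 0 := by
    rw [h]; exact cupPowOne_ne_zero_of_linearIndependent A hw
  have hli : LinearIndependent ℂ (fun i => u (w i)) := by
    by_contra hdep
    apply hne
    rw [← cupPowOneAlt_apply]
    exact AlternatingMap.map_linearDependent _ _ hdep
  exact Submodule.eq_of_le_of_finrank_le hle (by rw [finrank_span_eq_card hw, finrank_span_eq_card hli])

end Exterior

variable {φ : A ⟶ A} {P : Polynomial ℤ} {e r : ℕ} {u : complexBetti A.X 1 ≃ₗ[ℂ] complexBetti A.X 1}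
  {U : complexBetti A.X r →ₗ[ℂ] complexBetti A.X r}

/-! ### §2 Lemma (2), first half: identity on `W_F ⊗ ℂ` ⟹ `F`-linear -/

section FLinear

/-- **Identity on `W_F ⊗ ℂ` ⟹ every `V_ρ` is stable.**  For `P ∈ ℤ[T]` monic irreducible of degree `e`, `P(φ) = 0`,
`e · r = 2 dim A`, a multiplicative pair `(u, U)` (`U(v₁ ∪ ⋯ ∪ v_r) = u v₁ ∪ ⋯ ∪ u v_r`) with `U c = c` for every
`c ∈ weilClassesField A φ P r`, and a complex root `ρ` of `P`: `u` maps `V_ρ = ker(φ^* − ρ)` into itself (a basis `w` of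
`V_ρ` has `r` elements, `w₁ ∪ ⋯ ∪ w_r ∈ ⋀ʳ V_ρ ⊆ W_F ⊗ ℂ` is fixed, so `u w₁ ∪ ⋯ ∪ u w_r = w₁ ∪ ⋯ ∪ w_r` and §1 applies).
[cite: MoonenZarhin1998WeilClasses, §1 Lemma (2) and its proof (chunk p0003, lines 12–45)] -/
theorem mapsTo_eigenspace_of_forall_apply_eq_of_mem_weilClassesField (hPm : P.Monic) (hPe : P.natDegree = e)
    (hPirr : Irreducible (P.map (Int.castRingHom ℚ)))
    (hφ : Polynomial.eval₂ (Int.castRingHom (CategoryTheory.End A)) (φ : CategoryTheory.End A) P = 0)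
    (her : e * r = 2 * A.dim)
    (hU : ∀ v : Fin r → complexBetti A.X 1,
      U (cupPowOne ℂ (ComplexPoints A.X) r v) = cupPowOne ℂ (ComplexPoints A.X) r (fun i => u (v i)))
    (hfix : ∀ c ∈ weilClassesField A φ P r, U c = c) {ρ : ℂ}
    (hρ : Polynomial.eval₂ (Int.castRingHom ℂ) ρ P = 0) :
    Set.MapsTo (u : complexBetti A.X 1 →ₗ[ℂ] complexBetti A.X 1)
      (Module.End.eigenspace (pullbackOne A φ) ρ) (Module.End.eigenspace (pullbackOne A φ) ρ) := by
  classical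
  haveI : Module.Finite ℂ (complexBetti A.X 1) := finite_complexBetti_abelianVariety A 1
  set W := Module.End.eigenspace (pullbackOne A φ) ρ with hW
  have hdim : Module.finrank ℂ W = r := finrank_eigenspace_eq_of_root hPm hPe hPirr hφ her hρ
  let b := Module.finBasisOfFinrankEq ℂ W hdim
  let w : Fin r → complexBetti A.X 1 := fun i ↦ (b i : complexBetti A.X 1)
  have hwW : ∀ i, w i ∈ Module.End.eigenspace (complexBetti.map φ.hom.hom.hom 1).hom ρ := fun i ↦ (b i).2
  have hwli : LinearIndependent ℂ w := b.linearIndependent.map' W.subtype (Submodule.ker_subtype W)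
  -- `w₁ ∪ ⋯ ∪ w_r ∈ W_F ⊗ ℂ` is fixed, so `u w₁ ∪ ⋯ ∪ u w_r = w₁ ∪ ⋯ ∪ w_r`
  have hωW : cupPowOne ℂ (ComplexPoints A.X) r w ∈ weilClassesField A φ P r :=
    pullbackEigenclasses_le_weilClassesField hρ (cupPowOne_mem_pullbackEigenclasses_pow φ hwW)
  have heq : cupPowOne ℂ (ComplexPoints A.X) r (fun i => u (w i)) = cupPowOne ℂ (ComplexPoints A.X) r w := by
    rw [← hU]; exact hfix _ hωW
  -- the span of `w` is `V_ρ`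
  have hspan : Submodule.span ℂ (Set.range w) = W := by
    have hmap : Submodule.map W.subtype (Submodule.span ℂ (Set.range b)) = Submodule.span ℂ (Set.range w) := by
      rw [Submodule.map_span, ← Set.range_comp]
      rfl
    rw [← hmap, b.span_eq, Submodule.map_top, Submodule.range_subtype]
  intro x hx
  have hx' : x ∈ Submodule.span ℂ (Set.range w) := by rw [hspan]; exact hx
  rw [SetLike.mem_coe, ← hspan]
  refine Submodule.span_induction (p := fun y _ => (u : complexBetti A.X 1 →ₗ[ℂ] complexBetti A.X 1) y ∈
      Submodule.span ℂ (Set.range w)) ?_ ?_ ?_ ?_ hx'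
  · rintro _ ⟨i, rfl⟩
    exact apply_mem_span_of_cupPowOne_eq hwli u heq i
  · rw [map_zero]; exact Submodule.zero_mem _
  · intro y z _ _ hy hz; rw [map_add]; exact Submodule.add_mem _ hy hz
  · intro t y _ hy; rw [map_smul]; exact Submodule.smul_mem _ t hy

/-- **MOONEN–ZARHIN, LEMMA (2), FIRST HALF: «if `g` acts as the identity on `W_F` then `g` is `F`-linear»**, for an
ARBITRARY multiplicative pair `(u, U)` on `(H¹, Hʳ)(A(ℂ); ℂ)`: `U = id` on `W_F ⊗ ℂ = weilClassesField A φ P r` ⟹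
`u ∘ φ^* = φ^* ∘ u` (`H¹ = ⊕_ρ V_ρ` by an eigenbasis of `φ^*`, `exists_eigenbasis_complexBetti_one`, and each `V_ρ` is
`u`-stable). [cite: MoonenZarhin1998WeilClasses, §1 Lemma (2) (chunk p0003, lines 12–45)] -/
theorem comm_pullbackOne_of_forall_apply_eq_of_mem_weilClassesField (hPm : P.Monic) (hPe : P.natDegree = e)
    (hPirr : Irreducible (P.map (Int.castRingHom ℚ)))
    (hφ : Polynomial.eval₂ (Int.castRingHom (CategoryTheory.End A)) (φ : CategoryTheory.End A) P = 0)
    (her : e * r = 2 * A.dim)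
    (hU : ∀ v : Fin r → complexBetti A.X 1,
      U (cupPowOne ℂ (ComplexPoints A.X) r v) = cupPowOne ℂ (ComplexPoints A.X) r (fun i => u (v i)))
    (hfix : ∀ c ∈ weilClassesField A φ P r, U c = c) (x : complexBetti A.X 1) :
    u (pullbackOne A φ x) = pullbackOne A φ (u x) := by
  classical
  obtain ⟨N, b, lam, hlamP, hb⟩ := exists_eigenbasis_complexBetti_one hPirr hφ
  -- check on the eigenbasis
  suffices h : ((u : complexBetti A.X 1 →ₗ[ℂ] complexBetti A.X 1) ∘ₗ pullbackOne A φ) =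
      (pullbackOne A φ ∘ₗ (u : complexBetti A.X 1 →ₗ[ℂ] complexBetti A.X 1)) from LinearMap.congr_fun h x
  refine b.ext fun i => ?_
  have hbi : pullbackOne A φ (b i) = lam i • b i := Module.End.mem_eigenspace_iff.1 (hb i)
  have hubi : u (b i) ∈ Module.End.eigenspace (pullbackOne A φ) (lam i) :=
    mapsTo_eigenspace_of_forall_apply_eq_of_mem_weilClassesField hPm hPe hPirr hφ her hU hfix (hlamP i) (hb i)
  rw [LinearMap.comp_apply, LinearMap.comp_apply, hbi, map_smul, LinearEquiv.coe_coe,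
    Module.End.mem_eigenspace_iff.1 hubi]

end FLinear

/-! ### §3 Lemma (2), second half: identity on `W_F ⊗ ℂ` ⟹ `det(u | V_ρ) = 1` -/

section SLF

/-- Evaluating an alternating map on a basis transformed by an endomorphism multiplies the value by the determinant
(the `N`-valued form of Mathlib's `AlternatingMap.eq_smul_basis_det`, tested against all linear functionals). [folklore] -/
private theorem alternatingMap_apply_endomorphism_basis_eq_det_smul' {K V N ι : Type*} [Field K] [AddCommGroup V]
    [Module K V] [AddCommGroup N] [Module K N] [Fintype ι] [DecidableEq ι] (f : V [⋀^ι]→ₗ[K] N)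
    (b : Module.Basis ι K V) (g : V →ₗ[K] V) :
    f (fun i ↦ g (b i)) = LinearMap.det g • f b := by
  rw [← sub_eq_zero, ← Module.forall_dual_apply_eq_zero_iff K]
  intro lam
  have h := congrFun (congrArg DFunLike.coe ((lam.compAlternatingMap f).eq_smul_basis_det b)) (fun i ↦ g (b i))
  simp only [LinearMap.compAlternatingMap_apply, AlternatingMap.smul_apply, smul_eq_mul] at h
  rw [show (fun i ↦ g (b i)) = g ∘ b from rfl, Module.Basis.det_comp, Module.Basis.det_self, mul_one] at h
  rw [map_sub, map_smul]
  change lam (f (g ∘ b)) - _ = 0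
  rw [h, smul_eq_mul, mul_comm, sub_self]

/-- **An `F`-linear multiplicative pair acts on `⋀ʳ V_ρ` through `det(u | V_ρ)`**: if `u` commutes with `φ^*` then for
every `c ∈ ⋀ʳ V_ρ = pullbackEigenclasses A φ r ((x + yρ)ʳ)`, `U c = det(u | V_ρ) · c` (`dim V_ρ = r`; `U(w₁ ∪ ⋯ ∪ w_r) =
u w₁ ∪ ⋯ ∪ u w_r = det · (w₁ ∪ ⋯ ∪ w_r)` for a basis `w` of `V_ρ`, and `⋀ʳ V_ρ` is the line through `w₁ ∪ ⋯ ∪ w_r`) — the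
carrier form of «`Gl_F(V_X)` acts on `W_F` through the `F`-linear determinant».  [cite: MoonenZarhin1998WeilClasses, §1
(Remark after the Criterion; proof of Lemma (2))] [cite: vanGeemen1994HodgeAV, 6.9–6.10] -/
theorem apply_eq_detOnEigenspace_smul_of_comm (hPm : P.Monic) (hPe : P.natDegree = e)
    (hPirr : Irreducible (P.map (Int.castRingHom ℚ)))
    (hφ : Polynomial.eval₂ (Int.castRingHom (CategoryTheory.End A)) (φ : CategoryTheory.End A) P = 0)
    (her : e * r = 2 * A.dim)
    (hU : ∀ v : Fin r → complexBetti A.X 1,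
      U (cupPowOne ℂ (ComplexPoints A.X) r v) = cupPowOne ℂ (ComplexPoints A.X) r (fun i => u (v i)))
    (hc : ∀ x, u (pullbackOne A φ x) = pullbackOne A φ (u x)) {ρ : ℂ}
    (hρ : Polynomial.eval₂ (Int.castRingHom ℂ) ρ P = 0) {c : complexBetti A.X r}
    (hcW : c ∈ pullbackEigenclasses A φ r (fun x y => ((x : ℂ) + (y : ℂ) * ρ) ^ r)) :
    U c = detOnEigenspace u (pullbackOne A φ) hc ρ • c := by
  classical
  haveI : Module.Finite ℂ (complexBetti A.X 1) := finite_complexBetti_abelianVariety A 1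
  set W := Module.End.eigenspace (pullbackOne A φ) ρ with hW
  have hdim : Module.finrank ℂ W = r := finrank_eigenspace_eq_of_root hPm hPe hPirr hφ her hρ
  let b := Module.finBasisOfFinrankEq ℂ W hdim
  let w : Fin r → complexBetti A.X 1 := fun i ↦ (b i : complexBetti A.X 1)
  have hwW : ∀ i, w i ∈ Module.End.eigenspace (complexBetti.map φ.hom.hom.hom 1).hom ρ := fun i ↦ (b i).2
  have hwli : LinearIndependent ℂ w := b.linearIndependent.map' W.subtype (Submodule.ker_subtype W)
  set ω := cupPowOne ℂ (ComplexPoints A.X) r w with hω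
  have hω0 : ω ≠ 0 := cupPowOne_ne_zero_of_linearIndependent A hwli
  have hωmem : ω ∈ pullbackEigenclasses A φ r (fun x y => ((x : ℂ) + (y : ℂ) * ρ) ^ r) :=
    cupPowOne_mem_pullbackEigenclasses_pow φ hwW
  -- `U ω = det(u | V_ρ) • ω`
  let rW : W →ₗ[ℂ] W := (u : complexBetti A.X 1 →ₗ[ℂ] complexBetti A.X 1).restrict (mapsTo_eigenspace_of_comm hc ρ)
  let f : W [⋀^Fin r]→ₗ[ℂ] complexBetti A.X r := (cupPowOneAlt ℂ (ComplexPoints A.X) r).compLinearMap W.subtype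
  have hf : ∀ x : Fin r → W, f x = cupPowOne ℂ (ComplexPoints A.X) r (fun i ↦ (x i : complexBetti A.X 1)) :=
    fun _ ↦ rfl
  have hUω : U ω = detOnEigenspace u (pullbackOne A φ) hc ρ • ω := by
    rw [hω, hU]
    have : (fun i ↦ u (w i)) = fun i ↦ ((rW (b i) : W) : complexBetti A.X 1) := by
      funext i; rfl
    rw [this, ← hf, ← hf b]
    exact alternatingMap_apply_endomorphism_basis_eq_det_smul' f b rW
  -- every class of `⋀ʳ V_ρ` is a multiple of `ω`
  obtain ⟨ω₀, -, -, -, hgen⟩ := exists_generator_pullbackEigenclasses_of_root hPm hPe hPirr hφ her hρ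
  obtain ⟨t, ht⟩ := hgen c hcW
  obtain ⟨t', ht'⟩ := hgen ω hωmem
  have ht'0 : t' ≠ 0 := by
    rintro rfl
    exact hω0 (by rw [ht', zero_smul])
  have hcω : c = (t * t'⁻¹) • ω := by
    rw [ht', smul_smul, mul_assoc, inv_mul_cancel₀ ht'0, mul_one, ← ht]
  rw [hcω, map_smul, hUω, smul_comm]

/-- **MOONEN–ZARHIN, LEMMA (2), SECOND HALF: «… hence `g ∈ Sl_F(V)`»** for an arbitrary multiplicative pair: if `U = id`
on `W_F ⊗ ℂ` then, `u` being `F`-linear by §2, `det(u | V_ρ) = 1` at every complex root `ρ` of `P`.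
[cite: MoonenZarhin1998WeilClasses, §1 Lemma (2) (chunk p0003, lines 12–45)] -/
theorem detOnEigenspace_eq_one_of_forall_apply_eq_of_mem_weilClassesField (hPm : P.Monic)
    (hPe : P.natDegree = e) (hPirr : Irreducible (P.map (Int.castRingHom ℚ)))
    (hφ : Polynomial.eval₂ (Int.castRingHom (CategoryTheory.End A)) (φ : CategoryTheory.End A) P = 0)
    (her : e * r = 2 * A.dim)
    (hU : ∀ v : Fin r → complexBetti A.X 1,
      U (cupPowOne ℂ (ComplexPoints A.X) r v) = cupPowOne ℂ (ComplexPoints A.X) r (fun i => u (v i)))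
    (hfix : ∀ c ∈ weilClassesField A φ P r, U c = c) {ρ : ℂ}
    (hρ : Polynomial.eval₂ (Int.castRingHom ℂ) ρ P = 0) :
    detOnEigenspace u (pullbackOne A φ)
        (comm_pullbackOne_of_forall_apply_eq_of_mem_weilClassesField hPm hPe hPirr hφ her hU hfix) ρ = 1 := by
  obtain ⟨ω, hω, hω0, -, -⟩ := exists_generator_pullbackEigenclasses_of_root hPm hPe hPirr hφ her hρ
  have hdet := apply_eq_detOnEigenspace_smul_of_comm hPm hPe hPirr hφ her hU
    (comm_pullbackOne_of_forall_apply_eq_of_mem_weilClassesField hPm hPe hPirr hφ her hU hfix) hρ hω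
  rw [hfix ω (pullbackEigenclasses_le_weilClassesField hρ hω)] at hdet
  exact (smul_left_injective ℂ hω0 ((one_smul ℂ ω).trans hdet)).symm

end SLF

/-! ### §4 The converse and the equivalence -/

section Iff

/-- **`u ∈ Sl_F(V)(ℂ)` ⟹ `U = id` on `W_F ⊗ ℂ`** for a multiplicative pair: if `u` commutes with `φ^*` and
`det(u | V_ρ) = 1` at every complex root of `P`, then `U c = c` for every `c ∈ weilClassesField A φ P r` (§3 on each line
`⋀ʳ V_ρ`, and `W_F ⊗ ℂ = ⨆_ρ ⋀ʳ V_ρ`). [cite: MoonenZarhin1998WeilClasses, §1 Lemma (2) and Remark after the Criterion] -/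
theorem apply_eq_of_mem_weilClassesField_of_comm_of_detOnEigenspace_eq_one (hPm : P.Monic)
    (hPe : P.natDegree = e) (hPirr : Irreducible (P.map (Int.castRingHom ℚ)))
    (hφ : Polynomial.eval₂ (Int.castRingHom (CategoryTheory.End A)) (φ : CategoryTheory.End A) P = 0)
    (her : e * r = 2 * A.dim)
    (hU : ∀ v : Fin r → complexBetti A.X 1,
      U (cupPowOne ℂ (ComplexPoints A.X) r v) = cupPowOne ℂ (ComplexPoints A.X) r (fun i => u (v i)))
    (hc : ∀ x, u (pullbackOne A φ x) = pullbackOne A φ (u x))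
    (hdet : ∀ ρ : ℂ, Polynomial.eval₂ (Int.castRingHom ℂ) ρ P = 0 → detOnEigenspace u (pullbackOne A φ) hc ρ = 1)
    {c : complexBetti A.X r} (hcW : c ∈ weilClassesField A φ P r) : U c = c := by
  have hle : weilClassesField A φ P r ≤ LinearMap.ker (U - LinearMap.id) := by
    refine iSup₂_le fun ρ hρ => ?_
    intro x hx
    rw [LinearMap.mem_ker, LinearMap.sub_apply, LinearMap.id_apply,
      apply_eq_detOnEigenspace_smul_of_comm hPm hPe hPirr hφ her hU hc hρ hx, hdet ρ hρ, one_smul, sub_self]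
  have h := hle hcW
  rw [LinearMap.mem_ker, LinearMap.sub_apply, LinearMap.id_apply, sub_eq_zero] at h
  exact h

/-- **MOONEN–ZARHIN, LEMMA (2) AS AN EQUIVALENCE, for an arbitrary multiplicative pair `(u, U)` on `(H¹, Hʳ)(A(ℂ); ℂ)`**
(`P` monic irreducible of degree `e`, `P(φ) = 0`, `e · r = 2 dim A`): `U` is the identity on `W_F ⊗ ℂ` iff `u` is
`F`-linear (`u ∘ φ^* = φ^* ∘ u`) with `det(u | V_ρ) = 1` at every complex root `ρ` of `P` — i.e. iff `u ∈ Sl_F(V)(ℂ)`.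
[cite: MoonenZarhin1998WeilClasses, §1 Lemma (2) (chunk p0003, lines 12–45)] -/
theorem forall_apply_eq_of_mem_weilClassesField_iff (hPm : P.Monic) (hPe : P.natDegree = e)
    (hPirr : Irreducible (P.map (Int.castRingHom ℚ)))
    (hφ : Polynomial.eval₂ (Int.castRingHom (CategoryTheory.End A)) (φ : CategoryTheory.End A) P = 0)
    (her : e * r = 2 * A.dim)
    (hU : ∀ v : Fin r → complexBetti A.X 1,
      U (cupPowOne ℂ (ComplexPoints A.X) r v) = cupPowOne ℂ (ComplexPoints A.X) r (fun i => u (v i))) :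
    (∀ c ∈ weilClassesField A φ P r, U c = c) ↔
      ∃ hc : ∀ x, u (pullbackOne A φ x) = pullbackOne A φ (u x),
        ∀ ρ : ℂ, Polynomial.eval₂ (Int.castRingHom ℂ) ρ P = 0 → detOnEigenspace u (pullbackOne A φ) hc ρ = 1 :=
  ⟨fun hfix => ⟨comm_pullbackOne_of_forall_apply_eq_of_mem_weilClassesField hPm hPe hPirr hφ her hU hfix,
      fun _ hρ => detOnEigenspace_eq_one_of_forall_apply_eq_of_mem_weilClassesField hPm hPe hPirr hφ her hU hfix hρ⟩,
    fun ⟨hc, hdet⟩ _ hcW =>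
      apply_eq_of_mem_weilClassesField_of_comm_of_detOnEigenspace_eq_one hPm hPe hPirr hφ her hU hc hdet hcW⟩

end Iff

end HodgeTheory

end Literature.AlgebraicGeometry.HodgeTheory

end
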